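import Literature.MathematicalPhysics.QuantumFieldTheory.Balaban1983to89.Node00.Record12MinimiserSelection
import Literature.MathematicalPhysics.QuantumFieldTheory.Balaban1983to89.Node00.CriticalOnFibre
import Literature.MathematicalPhysics.QuantumFieldTheory.Balaban1983to89.Node00.Record13CoP
import Literature.MathematicalPhysics.QuantumFieldTheory.Balaban1983to89.Node00.LargeFieldBackgroundCoPOfRecordB
import Summits.QuantumFields.YangMills.Theorems.BalabanUVNodesN11BackgroundCoPMeasurableB

/-!
# DAG node N11 — def-R's BACKGROUND MAP OF RECORD `𝐖 ↦ U_k(𝐖)` (the CoP edition `UbgOfRecord₁₃CoP`, every level) IS MEASURABLE: K0c's measurable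
# selection of the (2.12) minimisers re-run for an arbitrary OPEN regularity class, and the openness of the class on a support ((1.7) ∧ (1.9), strict)

HEADER — WORK-UNIT METADATA.  Cell `pub-ymgap`, YM-PLAN Track A (HUMAN RULING D-0062), seat `pub-ymgap-dag-n11-d` (g10; R134 fan-out seat N11 [B14], strategy s2),
route `BalabanUVNodes` rev 25, item K1⁷ `StabilityBAtRecordR13SepCoPH` = stmt-QuantumFields-20542 (helper, `--kind proof --supports 20542 --as helper`, count-neutral).
[III] = [Balaban1988Convergent]; [15] = [Balaban1985Variational]; [6] = [Balaban1985RegularSpaces].  Over node00-def-K0c's `Node00.Record12MinimiserSelection`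
(`exists_measurable_isMinimizer_selector`: the selection theorem for the OPEN class `{U | PlaqSmall δ U}`, `sigmaClosedContinuous_iterUpTo`, `agreeOn_avgFamily_iff_fin`,
`agreeOn_of_isMinimizer_iff_of_exists`), def-R's `Node00.SmallFieldChiOfRecord` (`UminOfRecord` v2, `measurable_UminOfRecord_of_selector`), dag-n07-e's `Node00.CriticalOnFibre`
(`eventually_plaqSmallOn`, `eventually_coDivSmallOn`), def-R's `Node00.LargeFieldBackgroundCoPOfRecord` ∕ `Record13CoP` (`regMSCoPOfRecordAt`, `UbgMSCoPOfRecord(At)`, `UbgOfRecord₁₃CoP`)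
and `Literature.MeasureTheory.RandomSets.exists_measurable_constrained_argmin` — all CONSUMED BY NAME.

WHY THIS FILE.  This seat's specification of the no-expansion 𝐓-step with every row on a primitive (`…N11NoExpansionStepSpecificationOfTermRows`) carries ONE def-R row:
`Measurable (UbgOfRecord₁₃CoP F N θ p k (init s′))`.  def-R's (2.12) solution map `UminOfRecord av reg 𝔹` (v2) IS measurable as soon as a measurable, minimising,
unit-off-the-solvable-set, determined selector exists for `(av, reg, 𝔹)` (`measurable_UminOfRecord_of_selector`), and K0c proved such a selector exists for the class
`{PlaqSmall δ}` — using of that class ONLY that it is open.  The CoP background of record minimises over the class on a support `regMSCoPOfRecordAt` = finitely many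
STRICT plaquette ((1.7)) and co-divergence ((1.9)) inequalities between continuous functions of the configuration, hence open; its determining set `genSet s.Ω k` lives on
the scales `≤ k`.  So the row is a THEOREM, at every level, every history, every parameter.

WHAT THIS FILE PROVES (0 `sorry`, 0 `def`).  §1 ★ `exists_measurable_isMinimizer_selector_of_isOpen` and ★ `…_determined_of_isOpen` (K0c's §3∕§6 with the class a parameter
`reg`, hypothesis `IsOpen reg`), ★ `measurable_UminOfRecord_of_isOpen`.  §2 `isOpen_regMSCoPOfRecordAt`, `isOpen_regMSCoPOfRecord`, `genSet_eq_empty_of_lt`.  §3 ★★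
`measurable_UbgMSCoPOfRecordAt`, `measurable_UbgMSCoPOfRecord`, ★★★ `measurable_UbgOfRecord₁₃CoP` (every level `n`, every history `s`).

EDITION v1.1 (Stage-2 train, WORKPLAN-IIIB (iii-b), director-ym №343 (D5)∕(D6), row TRAIN-N11, seat g41): §3 gains the print-datum twins ★★ `measurable_UbgMSCoPOfRecordAtB` ∕
`measurable_UbgMSCoPOfRecordB` (node00-def-R's S2b `Node00.LargeFieldBackgroundCoPOfRecordB` + this seat's `…N11BackgroundCoPMeasurableB`), and the record-level
★★★ `measurable_UbgOfRecord₁₃CoP` is re-proved SEAM-ROBUSTLY (`apply_rules` over both measurability faces): its statement is byte-identical and it elaborates BEFORE and AFTER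
the `Record13CoP` seam edit re-points `UbgOfRecord₁₃CoP … (n+1)` to print's datum (FLAG №16 ∕ LOCATE-HSEAM 5d3298b8d191f169); every (b)-statement here stays landed and true.

HONEST FRAMING.  Helper lane of K1⁷; kernel theorems about the tree's own objects (compactness of `SU(N)^{bonds}`, a selection theorem, continuity); existence ∕
uniqueness of the (2.12) minimiser ([15] Thm 1) is NOT used and NOT asserted; nothing of Bałaban's analysis is asserted.  N11 NOT discharged; K1⁷ NOT closed; counts
unmoved (typed 28∕28 · discharged 5∕27).  One finite four-torus programme at fixed `ε = L^{−K}` — NOT ℝ⁴, NOT OS, NOT a mass gap, NOT Clay.  No `sorry`, `axiom`, `instance`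
(local `haveI` only, as in K0c), `notation`.
Sources (SHAPE only): [III] (2.2) p.255, (2.10)–(2.13) pp.256–257; [15] (2), (5)–(6) p.278; [6] (1.7)–(1.9) p.77.
-/

noncomputable section

open Set
open _root_.MeasureTheory _root_.TopologicalSpace

namespace Summit.QuantumFields.YangMills.Theorems.BalabanUVNodesN11BackgroundCoPMeasurable

open Literature.MathematicalPhysics.QuantumFieldTheory.Balaban1983to89 T4Continuum Node00 B15DeterminingSets B15DeterminingSetsB B14.Eq213DetSet B14.Eq216Concrete
open Summit.QuantumFields.YangMills.Theorems.BalabanUVNodesN11BackgroundCoPMeasurableB (measurable_UminOfRecordB_lamBondsSeq_of_isOpen)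
open Literature.MeasureTheory.RandomSets
open Literature.MathematicalPhysics.QuantumLattice (fundamentalRep continuous_fundamentalRep fundamentalRep_injective)

variable (F : T4Family) (N : ℕ) [NeZero N]

/-! ## §1  ★ K0c's measurable selection of the (2.12) minimisers, for an arbitrary OPEN regularity class -/

section Selector

/-- `Re tr` is continuous on `SU(N)` (private copy, as in K0c). [folklore] -/
private theorem continuous_reTr_SU' : Continuous (reTr : SU N → ℝ) :=
  UnitaryModel.continuous_nReTr.comp (continuous_fundamentalRep (Fin N))

/-- Plaquette variables are continuous in the configuration (private copy, as in K0c). [folklore] -/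
private theorem continuous_plaqHol' {P : Params} {j : ℕ} (p : Plaq P j) : Continuous fun U : GaugeField P j (SU N) => GaugeField.plaqHol U p := by
  have hb : ∀ b : PBond P j, Continuous fun U : GaugeField P j (SU N) => U b := fun b => continuous_apply b
  unfold GaugeField.plaqHol
  exact (((hb _).mul (hb _)).mul (hb _).inv).mul (hb _).inv

/-- The Wilson action is a continuous function of the configuration (private copy, as in K0c). [folklore] -/
private theorem continuous_wilsonAction4' {P : Params} {j : ℕ} : Continuous (wilsonAction4 : GaugeField P j (SU N) → ℝ) := by
  unfold wilsonAction4 wilsonAction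
  exact continuous_finsetSum _ fun p _ =>
    continuous_const.mul (continuous_const.sub ((continuous_reTr_SU' N).comp (continuous_plaqHol' N p)))

/-- **★ A MEASURABLE SELECTOR OF THE (2.12) MINIMISERS over an arbitrary OPEN regularity class `reg`** and a determining set supported on scales `≤ J`:
K0c's `exists_measurable_isMinimizer_selector` with the class a parameter — its proof uses of the class only that it is open.
[cite: Balaban1988Convergent, (2.12) p.256] -/
theorem exists_measurable_isMinimizer_selector_of_isOpen (K : ℕ) {reg : Set (GaugeField (F.P K) 0 (SU N))} (hreg : IsOpen reg) (𝔹 : DetSet (F.P K)) (J : ℕ)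
    (h𝔹 : ∀ j, J < j → 𝔹 j = ∅) :
    ∃ f : MSField (F.P K) (SU N) → GaugeField (F.P K) 0 (SU N), Measurable f ∧
      (∀ W, (∃ U₀, IsMinimizer (avOfRecord F N K) reg 𝔹 W U₀) → IsMinimizer (avOfRecord F N K) reg 𝔹 W (f W)) ∧
      (∀ W, ¬ (∃ U₀, IsMinimizer (avOfRecord F N K) reg 𝔹 W U₀) → f W = 1) := by
  -- the configuration spaces `SU(N)^{bonds}` are compact Polish with Borel = product σ-algebra (verbatim from K0c)
  have hemb : Topology.IsClosedEmbedding (fundamentalRep (Fin N)) :=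
    (continuous_fundamentalRep (Fin N)).isClosedEmbedding (fundamentalRep_injective (Fin N))
  haveI : SecondCountableTopology (SU N) := by
    haveI := secondCountableTopology_matrix (n := Fin N)
    exact hemb.isEmbedding.secondCountableTopology
  haveI : PolishSpace (SU N) := by
    haveI : PolishSpace (Matrix (Fin N) (Fin N) ℂ) := inferInstanceAs (PolishSpace (Fin N → Fin N → ℂ))
    exact hemb.polishSpace
  haveI : ∀ j, CompactSpace (GaugeField (F.P K) j (SU N)) := fun j => inferInstanceAs (CompactSpace (PBond (F.P K) j → SU N))
  haveI : PolishSpace (GaugeField (F.P K) 0 (SU N)) := inferInstanceAs (PolishSpace (PBond (F.P K) 0 → SU N))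
  haveI : ∀ j, SecondCountableTopology (GaugeField (F.P K) j (SU N)) := fun j =>
    inferInstanceAs (SecondCountableTopology (PBond (F.P K) j → SU N))
  haveI : ∀ j, BorelSpace (GaugeField (F.P K) j (SU N)) := fun j => inferInstanceAs (BorelSpace (PBond (F.P K) j → SU N))
  -- the data map `π`, the piecewise-continuous constraint map `g`, the closed relation `R`
  let Z : Type := (j : Fin (J + 1)) → GaugeField (F.P K) j (SU N)
  let π : MSField (F.P K) (SU N) → Z := fun W j => W j
  let g : GaugeField (F.P K) 0 (SU N) → Z := fun U j => Averaging.iter (avOfRecord F N K) j U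
  let R : Set (Z × Z) := {p | ∀ j : Fin (J + 1), ∀ b ∈ bondsOf (𝔹 j), p.1 j b = p.2 j b}
  have hπ : Measurable π := measurable_pi_lambda _ fun j => measurable_pi_apply _
  have hg : SigmaClosedContinuous g := sigmaClosedContinuous_iterUpTo F N K J
  have hcoord : ∀ (j : Fin (J + 1)) (b : PBond (F.P K) j), Continuous fun z : Z => z j b := fun j b =>
    (show Continuous fun V : GaugeField (F.P K) j (SU N) => V b from continuous_apply b).comp (continuous_apply j)
  have hR : IsClosed R := by
    simp only [R, setOf_forall]
    refine isClosed_iInter fun j => isClosed_iInter fun b => isClosed_iInter fun _ => ?_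
    exact isClosed_eq ((hcoord j b).comp continuous_fst) ((hcoord j b).comp continuous_snd)
  have hadm : ∀ (U : GaugeField (F.P K) 0 (SU N)) (W : MSField (F.P K) (SU N)),
      (U ∈ reg ∧ (g U, π W) ∈ R) ↔ (U ∈ reg ∧ AgreeOn 𝔹 (avgFamily (avOfRecord F N K) U) W) :=
    fun U W => and_congr Iff.rfl (agreeOn_avgFamily_iff_fin (avOfRecord F N K) h𝔹 U W).symm
  obtain ⟨f, hfm, hfin, hfout⟩ := exists_measurable_constrained_argmin hπ hg hreg hR
    (continuous_wilsonAction4' N (P := F.P K) (j := 0)) (1 : GaugeField (F.P K) 0 (SU N))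
  refine ⟨f, hfm, fun W hW => ?_, fun W hW => ?_⟩
  · obtain ⟨U₀, hU₀reg, hagree, hmin⟩ := hW
    have hex : ∃ y, (y ∈ reg ∧ (g y, π W) ∈ R) ∧ ∀ z, z ∈ reg ∧ (g z, π W) ∈ R → wilsonAction4 y ≤ wilsonAction4 z :=
      ⟨U₀, (hadm U₀ W).mpr ⟨hU₀reg, hagree⟩, fun z hz => hmin z ((hadm z W).mp hz).1 ((hadm z W).mp hz).2⟩
    obtain ⟨hf₁, hf₂⟩ := hfin W hex
    obtain ⟨hfreg, hfagree⟩ := (hadm (f W) W).mp hf₁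
    exact ⟨hfreg, hfagree, fun U hU hUa => hf₂ U ((hadm U W).mpr ⟨hU, hUa⟩)⟩
  · refine hfout W fun h => hW ?_
    obtain ⟨y, hy, hmin⟩ := h
    obtain ⟨hyreg, hyagree⟩ := (hadm y W).mp hy
    exact ⟨y, hyreg, hyagree, fun U hU hUa => hmin U ((hadm U W).mpr ⟨hU, hUa⟩)⟩

/-- **★ THE DETERMINED SELECTOR over an arbitrary open class**: §1's selector precomposed with the projection of the data onto the bonds of `𝔹` — a measurable,
minimising, unit-off-the-solvable-set selector that is a FUNCTION OF THE MINIMAL ORBIT (K0c's `…_determined`, class a parameter).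
[cite: Balaban1988Convergent, (2.10)–(2.12) p.256] -/
theorem exists_measurable_isMinimizer_selector_determined_of_isOpen (K : ℕ) {reg : Set (GaugeField (F.P K) 0 (SU N))} (hreg : IsOpen reg)
    (𝔹 : DetSet (F.P K)) (J : ℕ) (h𝔹 : ∀ j, J < j → 𝔹 j = ∅) :
    ∃ f : MSField (F.P K) (SU N) → GaugeField (F.P K) 0 (SU N), Measurable f ∧
      (∀ W, (∃ U₀, IsMinimizer (avOfRecord F N K) reg 𝔹 W U₀) → IsMinimizer (avOfRecord F N K) reg 𝔹 W (f W)) ∧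
      (∀ W, ¬ (∃ U₀, IsMinimizer (avOfRecord F N K) reg 𝔹 W U₀) → f W = 1) ∧
      (∀ W W', (∀ U₀, IsMinimizer (avOfRecord F N K) reg 𝔹 W U₀ ↔ IsMinimizer (avOfRecord F N K) reg 𝔹 W' U₀) → f W = f W') := by
  classical
  obtain ⟨f₀, hf₀m, hf₀in, hf₀out⟩ := exists_measurable_isMinimizer_selector_of_isOpen F N K hreg 𝔹 J h𝔹
  -- the projection of the data onto the bonds of `𝔹` (unit elsewhere)
  let π : MSField (F.P K) (SU N) → MSField (F.P K) (SU N) := fun W j b => if b ∈ bondsOf (𝔹 j) then W j b else 1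
  have hπm : Measurable π := by
    refine measurable_pi_lambda _ fun j => measurable_pi_lambda _ fun b => ?_
    by_cases hb : b ∈ bondsOf (𝔹 j)
    · simp only [π, if_pos hb]
      exact (measurable_pi_apply b).comp (measurable_pi_apply j)
    · simp only [π, if_neg hb]
      exact measurable_const
  have hagree : ∀ (V W : MSField (F.P K) (SU N)), AgreeOn 𝔹 V (π W) ↔ AgreeOn 𝔹 V W := fun V W => by
    refine forall_congr' fun j => forall_congr' fun b => forall_congr' fun hb => ?_
    simp only [π, if_pos hb]
  have hmin : ∀ (W : MSField (F.P K) (SU N)) (U₀ : GaugeField (F.P K) 0 (SU N)),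
      IsMinimizer (avOfRecord F N K) reg 𝔹 (π W) U₀ ↔ IsMinimizer (avOfRecord F N K) reg 𝔹 W U₀ := fun W U₀ => by
    simp only [IsMinimizer, hagree]
  have hπeq : ∀ W W' : MSField (F.P K) (SU N),
      (∀ U₀, IsMinimizer (avOfRecord F N K) reg 𝔹 W U₀ ↔ IsMinimizer (avOfRecord F N K) reg 𝔹 W' U₀) →
      (∃ U₀, IsMinimizer (avOfRecord F N K) reg 𝔹 W U₀) → π W = π W' := fun W W' h hW => by
    have hWW' : AgreeOn 𝔹 W W' := agreeOn_of_isMinimizer_iff_of_exists (avOfRecord F N K) _ h hW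
    funext j b
    by_cases hb : b ∈ bondsOf (𝔹 j)
    · simp only [π, if_pos hb]
      exact hWW' j b hb
    · simp only [π, if_neg hb]
  refine ⟨f₀ ∘ π, hf₀m.comp hπm, fun W hW => ?_, fun W hW => ?_, fun W W' h => ?_⟩
  · exact (hmin W _).mp (hf₀in (π W) (by obtain ⟨U₀, hU₀⟩ := hW; exact ⟨U₀, (hmin W U₀).mpr hU₀⟩))
  · exact hf₀out (π W) fun ⟨U₀, hU₀⟩ => hW ⟨U₀, (hmin W U₀).mp hU₀⟩
  · by_cases hW : ∃ U₀, IsMinimizer (avOfRecord F N K) reg 𝔹 W U₀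
    · show f₀ (π W) = f₀ (π W')
      rw [hπeq W W' h hW]
    · have hW' : ¬ ∃ U₀, IsMinimizer (avOfRecord F N K) reg 𝔹 W' U₀ := fun ⟨U₀, hU₀⟩ => hW ⟨U₀, (h U₀).mpr hU₀⟩
      show f₀ (π W) = f₀ (π W')
      rw [hf₀out (π W) fun ⟨U₀, hU₀⟩ => hW ⟨U₀, (hmin W U₀).mp hU₀⟩,
        hf₀out (π W') fun ⟨U₀, hU₀⟩ => hW' ⟨U₀, (hmin W' U₀).mp hU₀⟩]

/-- **★ def-R's (2.12) SOLUTION MAP OF RECORD IS MEASURABLE over every OPEN regularity class** and every determining set supported on finitely many scales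
(`UminOfRecord` v2 prefers a predicate-fed measurable selector when one exists: `measurable_UminOfRecord_of_selector`).
[cite: Balaban1988Convergent, (2.12)–(2.13) pp.256–257] -/
theorem measurable_UminOfRecord_of_isOpen (K : ℕ) {reg : Set (GaugeField (F.P K) 0 (SU N))} (hreg : IsOpen reg) (𝔹 : DetSet (F.P K)) (J : ℕ)
    (h𝔹 : ∀ j, J < j → 𝔹 j = ∅) : Measurable (UminOfRecord (avOfRecord F N K) reg 𝔹) := by
  obtain ⟨f, hf, hmin, hjunk, hdet⟩ := exists_measurable_isMinimizer_selector_determined_of_isOpen F N K hreg 𝔹 J h𝔹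
  exact measurable_UminOfRecord_of_selector _ _ f hf hmin hjunk hdet

end Selector

/-! ## §2  The class on a support is open; the determining set of a sequence lives on the scales `≤ k` -/

section ClassOpen

/-- **THE CLASS ON A SUPPORT IS OPEN**: `regMSCoPOfRecordAt` is cut out by finitely many STRICT inequalities (1.7) `|U(∂p) − 1| < ε η_j²` and (1.9)
`‖η·(D^{η*}_U ∂U)(b)‖ < ε η_j³` between continuous functions of the configuration (`eventually_plaqSmallOn`, `eventually_coDivSmallOn`).
[cite: Balaban1985Variational, (2) p.278; Balaban1985RegularSpaces, (1.7)–(1.9) p.77] -/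
theorem isOpen_regMSCoPOfRecordAt (ν : Stage7Numerics) (K k : ℕ) (Ω₀ : Set (Site (F.P K) 0)) (Ω : ℕ → Set (Site (F.P K) 0)) :
    IsOpen (regMSCoPOfRecordAt F N ν K k Ω₀ Ω) := by
  rw [isOpen_iff_eventually]
  intro U₀ hU₀
  have hγ : ContinuousAt (fun (U : GaugeField (F.P K) 0 (SU N)) (b : PBond (F.P K) 0) => U b) U₀ := continuousAt_id
  have h1 : ∀ j ∈ Set.Iic k, ∀ᶠ U in nhds U₀,
      PlaqSmallOn (B8Eq17ClassAkV1.plaqsOf (topSeq Ω₀ Ω j)) (ν.εreg * (F.P K).eta j ^ 2) U :=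
    fun j hj => eventually_plaqSmallOn hγ (hU₀.1 j hj)
  have h2 : ∀ j ∈ Set.Iic k, ∀ᶠ U in nhds U₀,
      Sect2.CoDivSmallOn (bondsOf (topSeq Ω₀ Ω j)) (ν.εreg * (F.P K).eta j ^ 3) U :=
    fun j hj => eventually_coDivSmallOn hγ (hU₀.2 j hj)
  have h1' := (Set.finite_Iic k).eventually_all.2 h1
  have h2' := (Set.finite_Iic k).eventually_all.2 h2
  exact (h1'.and h2').mono fun U hU => ⟨fun j hj => hU.1 j hj, fun j hj => hU.2 j hj⟩

/-- The class of record (on the support of record) is open. [cite: Balaban1985Variational, (2) p.278; Balaban1988Convergent, (2.12) p.256] -/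
theorem isOpen_regMSCoPOfRecord (ν : Stage7Numerics) (K k : ℕ) (Ω : ℕ → Set (Site (F.P K) 0)) : IsOpen (regMSCoPOfRecord F N ν K k Ω) :=
  isOpen_regMSCoPOfRecordAt F N ν K k _ Ω

omit [NeZero N] in
/-- The determining set (2.2) of a sequence of length `k` has no member above scale `k`. [cite: Balaban1988Convergent, (2.2) p.255] -/
theorem genSet_eq_empty_of_lt {P : Params} (Ω : ℕ → Set (Site P 0)) {k i : ℕ} (h : k < i) : genSet Ω k i = ∅ := by
  unfold genSet gammaRegion
  rw [if_pos h]
  ext x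
  simp

end ClassOpen

/-! ## §3  ★★★ def-R's background map of record is measurable, every level -/

section Background

/-- **★★ THE BACKGROUND ON A SUPPORT IS A MEASURABLE MAP OF THE MULTISCALE FIELD**: `𝐖 ↦ U_k(s)(𝐖)` = def-R's `UminOfRecord` over the open class on a support and
the determining set `genSet s.Ω k` (scales `≤ k`). [cite: Balaban1988Convergent, (2.12)–(2.13) pp.256–257; Balaban1985Variational, (5)–(6) p.278] -/
theorem measurable_UbgMSCoPOfRecordAt (ν : Stage7Numerics) (M : ℕ) (g : ℕ → ℝ) (K k : ℕ) (Ω₀ : Set (Site (F.P K) 0)) (s : SeqOfRecord F ν M g K k) :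
    Measurable (UbgMSCoPOfRecordAt F N ν M g K k Ω₀ s) := by
  have h : UbgMSCoPOfRecordAt F N ν M g K k Ω₀ s = UminOfRecord (avOfRecord F N K) (regMSCoPOfRecordAt F N ν K k Ω₀ s.Ω) (genSet s.Ω k) :=
    funext fun W => UbgMSCoPOfRecordAt_apply ν M g K k Ω₀ s W
  rw [h]
  exact measurable_UminOfRecord_of_isOpen F N K (isOpen_regMSCoPOfRecordAt F N ν K k Ω₀ s.Ω) (genSet s.Ω k) k fun j hj => genSet_eq_empty_of_lt s.Ω hj

/-- **★★ THE BACKGROUND OF RECORD (support edition) IS MEASURABLE.** [cite: Balaban1988Convergent, (2.12)–(2.13) pp.256–257] -/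
theorem measurable_UbgMSCoPOfRecord (ν : Stage7Numerics) (M : ℕ) (g : ℕ → ℝ) (K k : ℕ) (s : SeqOfRecord F ν M g K k) :
    Measurable (UbgMSCoPOfRecord F N ν M g K k s) :=
  measurable_UbgMSCoPOfRecordAt F N ν M g K k _ s

/-- **★★ def-R's PRINT-DATUM BACKGROUND ON A SUPPORT `𝐖 ↦ U_k(s)(𝐖)` over `Λ({Ω_j(s)}) = lamBondsSeq s.Ω k` IS MEASURABLE** for every `ν, M, g, K, k, Ω₀, s` — print-datum twin of
`measurable_UbgMSCoPOfRecordAt` (FLAG №16 ∕ LOCATE-HSEAM 5d3298b8d191f169; the (b)-instance stays landed and true on its own text, just above): `…N11BackgroundCoPMeasurableB`'s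
selector over a bond-level datum + §2's openness of the class on a support. [cite: Balaban1988Convergent, (2.12)–(2.13) pp.256–257; Balaban1985Variational, (5)–(6) p.278; Balaban1984PropagatorsII, (2.3) p.224] -/
theorem measurable_UbgMSCoPOfRecordAtB (ν : Stage7Numerics) (M : ℕ) (g : ℕ → ℝ) (K k : ℕ) (Ω₀ : Set (Site (F.P K) 0)) (s : SeqOfRecord F ν M g K k) :
    Measurable (UbgMSCoPOfRecordAtB F N ν M g K k Ω₀ s) := by
  have h : UbgMSCoPOfRecordAtB F N ν M g K k Ω₀ s = UminOfRecordB (avOfRecord F N K) (regMSCoPOfRecordAt F N ν K k Ω₀ s.Ω) (lamBondsSeq s.Ω k) :=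
    funext fun W => UbgMSCoPOfRecordAtB_apply ν M g K k Ω₀ s W
  rw [h]
  exact measurable_UminOfRecordB_lamBondsSeq_of_isOpen F N K (isOpen_regMSCoPOfRecordAt F N ν K k Ω₀ s.Ω) s.Ω k

/-- **★★ def-R's PRINT-DATUM BACKGROUND OF RECORD (support `Ω₀(s)`) IS MEASURABLE** — print-datum twin of `measurable_UbgMSCoPOfRecord` (FLAG №16 ∕ LOCATE-HSEAM 5d3298b8d191f169;
the (b)-instance stays landed and true on its own text). [cite: Balaban1988Convergent, (2.12)–(2.13) pp.256–257; Balaban1984PropagatorsII, (2.3) p.224] -/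
theorem measurable_UbgMSCoPOfRecordB (ν : Stage7Numerics) (M : ℕ) (g : ℕ → ℝ) (K k : ℕ) (s : SeqOfRecord F ν M g K k) :
    Measurable (UbgMSCoPOfRecordB F N ν M g K k s) :=
  measurable_UbgMSCoPOfRecordAtB F N ν M g K k _ s

/-- **★★★ def-R's STAGE-13 BACKGROUND MAP OF RECORD `UbgOfRecord₁₃CoP F N θ p n s` IS MEASURABLE, EVERY LEVEL `n`, EVERY HISTORY `s`** (level `0`: the scale-0 field
`𝐖 ↦ 𝐖 0`; level `n+1`: §3's background on the support of record) — the def-R row of this seat's `…N11NoExpansionStepSpecificationOfTermRows` is a theorem.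
[cite: Balaban1988Convergent, Thm 1 p.262, (2.12)–(2.13) pp.256–257] -/
theorem measurable_UbgOfRecord₁₃CoP (θ : Stage13Params F N) (p : B12.RunParams) :
    ∀ (n : ℕ) (s : SeqOfRecord F θ.ν θ.τ9.M (gOfRecord₁₃ F N θ p) p.K n), Measurable (UbgOfRecord₁₃CoP F N θ p n s)
  | 0, s => by
    rw [UbgOfRecord₁₃CoP_zero]
    exact measurable_pi_apply 0
  | n + 1, s => by
    -- Stage-2 SEAM-ROBUST (WORKPLAN-IIIB, director-ym №343): `UbgOfRecord₁₃CoP_succ` unfolds to the (b)-datum background before the `Record13CoP` seam edit and to the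
    -- print-datum background `UbgMSCoPOfRecordB` after it; both are measurable (§3), so this proof elaborates in either state of the tree.
    rw [UbgOfRecord₁₃CoP_succ]
    apply_rules [measurable_UbgMSCoPOfRecord, measurable_UbgMSCoPOfRecordB]

end Background

end Summit.QuantumFields.YangMills.Theorems.BalabanUVNodesN11BackgroundCoPMeasurable

end
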